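import Mathlib
import Summits.PneNP.PneNP.Theorems.Nc03AvoidResidualCoreReductionSolveA
import Summits.PneNP.PneNP.Theorems.Nc03AvoidResidualCoreReductionSolveB
import Summits.PneNP.PneNP.Theorems.Nc03AvoidResidualCoreReductionSolveD
import Summits.PneNP.PneNP.Theorems.Nc03AvoidResidualCoreReductionSolveE
import Summits.PneNP.PneNP.Theorems.Nc03AvoidResidualCoreReductionSolve12
import Summits.PneNP.PneNP.Theorems.Nc03AvoidResidualCoreReductionCand

/-!
# Route Nc03AvoidResidualCore, item `ResidualCoreReduction` — the solver, XVII: assembly (correctness)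

Helper file for `stmt-PneNP-20227` (cell pnp-ideate). The whole solver on raw instances: the class
choice `chooseClass` (the least class `c ≤ 12` whose bucket exceeds its threshold `thr c · 6n`,
else the `CAND` class `13`), the dispatch `solveC` to the fourteen class solvers, and the output
`outBits` (solve the relaxed bucket, scatter with negations). **`outBits_correct`**: given an oracle
`f₀` correct on pure `CAND` instances with `0 < N`, `C₀ N ≤ M`, for every instance with `0 < n` and
`(6 C₀ + 150) n ≤ m` the output, read as a pattern, is outside the range. (Counting: the thresholds
sum to `25 · 6n = 150 n`, so if no class `≤ 12` qualifies the `CAND` bucket has `≥ 6 C₀ n` outputs.)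
-/

set_option linter.dupNamespace false -- `Summit.PneNP.PneNP.…`: summit = sub-problem name (D-0017 single-conjunct layout)

namespace Summit.PneNP.PneNP.Theorems.Nc03Reduction

open Literature.Computability.Complexity CodeFP

/-! ## Programs -/

/-- The class thresholds, in units of `N' = 6n`. -/
def thrTab : List ℕ := [0, 1, 1, 1, 1, 3, 5, 1, 1, 2, 2, 2, 5]

/-- The threshold of class `c`. -/
def thr (c : ℕ) : ℕ := thrTab.getD c 0

/-- The size of the bucket of class `c`. -/
def cntC (recs : List Rec) (c : ℕ) : ℕ := (bucket recs c).length

/-- The class test: the bucket of class `c` exceeds its threshold. -/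
def classOK (ri : RI) (c : ℕ) : Bool := decide (thr c * (6 * ri.1) < cntC ri.2.2 c)

/-- The chosen class: the least qualifying class `≤ 12`, else `13`. -/
def chooseClass (ri : RI) : ℕ := ((List.range 13).find? fun c => classOK ri c).getD 13

/-- Dispatch to the class solvers. -/
def solveC (f₀ : List Bool → List Bool) (c : ℕ) (pr : PRaw) : List Bool :=
  if decide (c = 0) then sol0 pr else if decide (c = 1) then sol1 pr else if decide (c = 2) then sol2 pr else
  if decide (c = 3) then sol3 pr else if decide (c = 4) then sol4 pr else if decide (c = 5) then sol5 pr else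
  if decide (c = 6) then sol6 pr else if decide (c = 7) then sol7 pr else if decide (c = 8) then sol8 pr else
  if decide (c = 9) then sol9 pr else if decide (c = 10) then sol10 pr else if decide (c = 11) then sol11 pr else
  if decide (c = 12) then sol12 pr else sol13 f₀ pr

/-- The solver on raw instances: solve the relaxed bucket of the chosen class and scatter. -/
def outBits (f₀ : List Bool → List Bool) (ri : RI) : List Bool :=
  scatter ri.2.2 (chooseClass ri) (solveC f₀ (chooseClass ri) (pureOf ri (chooseClass ri)))

/-! ## Counting -/

section Count

variable {n m : ℕ} (I : LocalMap 3 n m)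

/-- The bucket sizes of an instance. -/
theorem cntC_toRaw (c : ℕ) : cntC (toRaw ⟨n, m, I⟩).2.2 c = Mb I c := rfl

/-- Filtering a cons: the length grows by one exactly when the head passes. -/
theorem length_filter_cons {α : Type} (p : α → Bool) (x : α) (L : List α) :
    ((x :: L).filter p).length = (if p x = true then 1 else 0) + (L.filter p).length := by
  rw [List.filter_cons]
  split <;> simp [Nat.add_comm]

/-- Partition count: classes `< 14` partition a list of indexed records. -/
theorem sum_filter_cls (L : List (ℕ × Rec)) (h : ∀ q ∈ L, clsOf q.2 < 14) :
    ∑ c ∈ Finset.range 14, (L.filter fun q => decide (clsOf q.2 = c)).length = L.length := by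
  induction L with
  | nil => simp
  | cons x L ih =>
    have hx := h x (by simp)
    simp only [length_filter_cons, Finset.sum_add_distrib, List.length_cons, decide_eq_true_eq]
    rw [ih (fun q hq => h q (by simp [hq])), Finset.sum_ite_eq, if_pos (Finset.mem_range.2 hx)]
    omega

/-- **The buckets partition the outputs.** -/
theorem sum_Mb : ∑ c ∈ Finset.range 14, Mb I c = m := by
  have h := sum_filter_cls ((List.range (List.ofFn (recOf I)).length).zip (List.ofFn (recOf I))) (fun q hq => by
    obtain ⟨i, hi, hget⟩ := List.getElem_of_mem hq
    rw [List.getElem_zip] at hget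
    rw [← hget]
    simp only [List.getElem_ofFn]
    exact npnOf_class_lt _)
  unfold Mb bucket
  rw [h, List.length_zip, List.length_range, List.length_ofFn, min_self]

/-- The thresholds sum to `25`. -/
theorem sum_thr : ∑ c ∈ Finset.range 13, thr c = 25 := by decide

end Count

/-! ## The class choice -/

/-- The class choice: either a qualifying class `≤ 12`, or `13` with no class `≤ 12` qualifying. -/
theorem chooseClass_spec (ri : RI) :
    (chooseClass ri < 13 ∧ classOK ri (chooseClass ri) = true) ∨
      (chooseClass ri = 13 ∧ ∀ c < 13, classOK ri c = false) := by
  unfold chooseClass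
  cases h : (List.range 13).find? (fun c => classOK ri c) with
  | none =>
    right
    refine ⟨rfl, fun c hc => ?_⟩
    have := List.find?_eq_none.1 h c (List.mem_range.2 hc)
    simpa using this
  | some c =>
    left
    exact ⟨List.mem_range.1 (List.mem_of_find?_eq_some h), List.find?_some h⟩

/-! ## Correctness -/

section Correct

variable {n m : ℕ} (I : LocalMap 3 n m) {f₀ : List Bool → List Bool} {C₀ : ℕ}

/-- Dispatch, unfolded at a class. -/
theorem solveC_of (c : ℕ) (pr : PRaw) :
    solveC f₀ c pr = (if c = 0 then sol0 pr else if c = 1 then sol1 pr else if c = 2 then sol2 pr else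
      if c = 3 then sol3 pr else if c = 4 then sol4 pr else if c = 5 then sol5 pr else
      if c = 6 then sol6 pr else if c = 7 then sol7 pr else if c = 8 then sol8 pr else
      if c = 9 then sol9 pr else if c = 10 then sol10 pr else if c = 11 then sol11 pr else
      if c = 12 then sol12 pr else sol13 f₀ pr) := by
  unfold solveC; simp only [decide_eq_true_eq]

/-- Class `0`: the dispatched solver is correct on the relaxed bucket and has the right length. -/
theorem solveC_correct_0 (_hn : 0 < n) (hok : thr 0 * (6 * n) < Mb I 0) :
    (solveC f₀ 0 (rawOf (Jb I 0))).length = Mb I 0 ∧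
      (fun p : Fin (Mb I 0) => (solveC f₀ 0 (rawOf (Jb I 0))).getD p.val false) ∉ (Jb I 0).range := by
  have hP := Jb_isPure I 0
  rw [show solveC f₀ 0 (rawOf (Jb I 0)) = sol0 (rawOf (Jb I 0)) from rfl]
  rw [show thr 0 = 0 from rfl] at hok
  refine ⟨?_, sol0_correct (Jb I 0) hP (by omega)⟩
  rw [length_sol0]; rfl

/-- Class `1`: the dispatched solver is correct on the relaxed bucket and has the right length. -/
theorem solveC_correct_1 (_hn : 0 < n) (hok : thr 1 * (6 * n) < Mb I 1) :
    (solveC f₀ 1 (rawOf (Jb I 1))).length = Mb I 1 ∧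
      (fun p : Fin (Mb I 1) => (solveC f₀ 1 (rawOf (Jb I 1))).getD p.val false) ∉ (Jb I 1).range := by
  have hP := Jb_isPure I 1
  rw [show solveC f₀ 1 (rawOf (Jb I 1)) = sol1 (rawOf (Jb I 1)) from rfl]
  rw [show thr 1 = 1 from rfl] at hok
  refine ⟨?_, sol1_correct (Jb I 1) hP (by omega)⟩
  rw [length_sol1]; rfl

/-- Class `2`: the dispatched solver is correct on the relaxed bucket and has the right length. -/
theorem solveC_correct_2 (_hn : 0 < n) (hok : thr 2 * (6 * n) < Mb I 2) :
    (solveC f₀ 2 (rawOf (Jb I 2))).length = Mb I 2 ∧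
      (fun p : Fin (Mb I 2) => (solveC f₀ 2 (rawOf (Jb I 2))).getD p.val false) ∉ (Jb I 2).range := by
  have hP := Jb_isPure I 2
  rw [show solveC f₀ 2 (rawOf (Jb I 2)) = sol2 (rawOf (Jb I 2)) from rfl]
  rw [show thr 2 = 1 from rfl] at hok
  refine ⟨?_, sol2_correct (Jb I 2) hP (by omega)⟩
  rw [length_sol2]; rfl

/-- Class `3`: the dispatched solver is correct on the relaxed bucket and has the right length. -/
theorem solveC_correct_3 (_hn : 0 < n) (hok : thr 3 * (6 * n) < Mb I 3) :
    (solveC f₀ 3 (rawOf (Jb I 3))).length = Mb I 3 ∧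
      (fun p : Fin (Mb I 3) => (solveC f₀ 3 (rawOf (Jb I 3))).getD p.val false) ∉ (Jb I 3).range := by
  have hP := Jb_isPure I 3
  rw [show solveC f₀ 3 (rawOf (Jb I 3)) = sol3 (rawOf (Jb I 3)) from rfl]
  rw [show thr 3 = 1 from rfl] at hok
  refine ⟨?_, sol3_correct (Jb I 3) hP (by omega)⟩
  show (solPS _ (rawOf (Jb I 3))).length = Mb I 3
  rw [length_solPS]; rfl

/-- Class `4`: the dispatched solver is correct on the relaxed bucket and has the right length. -/
theorem solveC_correct_4 (_hn : 0 < n) (hok : thr 4 * (6 * n) < Mb I 4) :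
    (solveC f₀ 4 (rawOf (Jb I 4))).length = Mb I 4 ∧
      (fun p : Fin (Mb I 4) => (solveC f₀ 4 (rawOf (Jb I 4))).getD p.val false) ∉ (Jb I 4).range := by
  have hP := Jb_isPure I 4
  rw [show solveC f₀ 4 (rawOf (Jb I 4)) = sol4 (rawOf (Jb I 4)) from rfl]
  rw [show thr 4 = 1 from rfl] at hok
  refine ⟨?_, sol4_correct (Jb I 4) hP (by omega)⟩
  rw [length_sol4]; rfl

/-- Class `5`: the dispatched solver is correct on the relaxed bucket and has the right length. -/
theorem solveC_correct_5 (_hn : 0 < n) (hok : thr 5 * (6 * n) < Mb I 5) :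
    (solveC f₀ 5 (rawOf (Jb I 5))).length = Mb I 5 ∧
      (fun p : Fin (Mb I 5) => (solveC f₀ 5 (rawOf (Jb I 5))).getD p.val false) ∉ (Jb I 5).range := by
  have hP := Jb_isPure I 5
  rw [show solveC f₀ 5 (rawOf (Jb I 5)) = sol5 (rawOf (Jb I 5)) from rfl]
  rw [show thr 5 = 3 from rfl] at hok
  refine ⟨?_, sol5_correct (Jb I 5) hP (by omega)⟩
  rw [length_sol5]; rfl

/-- Class `6`: the dispatched solver is correct on the relaxed bucket and has the right length. -/
theorem solveC_correct_6 (_hn : 0 < n) (hok : thr 6 * (6 * n) < Mb I 6) :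
    (solveC f₀ 6 (rawOf (Jb I 6))).length = Mb I 6 ∧
      (fun p : Fin (Mb I 6) => (solveC f₀ 6 (rawOf (Jb I 6))).getD p.val false) ∉ (Jb I 6).range := by
  have hP := Jb_isPure I 6
  rw [show solveC f₀ 6 (rawOf (Jb I 6)) = sol6 (rawOf (Jb I 6)) from rfl]
  rw [show thr 6 = 5 from rfl] at hok
  haveI : NeZero (Mb I 6) := ⟨by omega⟩
  exact ⟨length_sol6 (Jb I 6), sol6_correct (Jb I 6) hP (by omega)⟩

/-- Class `7`: the dispatched solver is correct on the relaxed bucket and has the right length. -/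
theorem solveC_correct_7 (_hn : 0 < n) (hok : thr 7 * (6 * n) < Mb I 7) :
    (solveC f₀ 7 (rawOf (Jb I 7))).length = Mb I 7 ∧
      (fun p : Fin (Mb I 7) => (solveC f₀ 7 (rawOf (Jb I 7))).getD p.val false) ∉ (Jb I 7).range := by
  have hP := Jb_isPure I 7
  rw [show solveC f₀ 7 (rawOf (Jb I 7)) = sol7 (rawOf (Jb I 7)) from rfl]
  rw [show thr 7 = 1 from rfl] at hok
  refine ⟨?_, sol7_correct (Jb I 7) hP (by omega)⟩
  show (solPS _ (rawOf (Jb I 7))).length = Mb I 7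
  rw [length_solPS]; rfl

/-- Class `8`: the dispatched solver is correct on the relaxed bucket and has the right length. -/
theorem solveC_correct_8 (_hn : 0 < n) (hok : thr 8 * (6 * n) < Mb I 8) :
    (solveC f₀ 8 (rawOf (Jb I 8))).length = Mb I 8 ∧
      (fun p : Fin (Mb I 8) => (solveC f₀ 8 (rawOf (Jb I 8))).getD p.val false) ∉ (Jb I 8).range := by
  have hP := Jb_isPure I 8
  rw [show solveC f₀ 8 (rawOf (Jb I 8)) = sol8 (rawOf (Jb I 8)) from rfl]
  rw [show thr 8 = 1 from rfl] at hok
  refine ⟨?_, sol8_correct (Jb I 8) hP (by omega)⟩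
  rw [length_sol8]; rfl

/-- Class `9`: the dispatched solver is correct on the relaxed bucket and has the right length. -/
theorem solveC_correct_9 (_hn : 0 < n) (hok : thr 9 * (6 * n) < Mb I 9) :
    (solveC f₀ 9 (rawOf (Jb I 9))).length = Mb I 9 ∧
      (fun p : Fin (Mb I 9) => (solveC f₀ 9 (rawOf (Jb I 9))).getD p.val false) ∉ (Jb I 9).range := by
  have hP := Jb_isPure I 9
  rw [show solveC f₀ 9 (rawOf (Jb I 9)) = sol9 (rawOf (Jb I 9)) from rfl]
  rw [show thr 9 = 2 from rfl] at hok
  exact ⟨length_sol9 (Jb I 9), sol9_correct (Jb I 9) hP (by omega)⟩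

/-- Class `10`: the dispatched solver is correct on the relaxed bucket and has the right length. -/
theorem solveC_correct_10 (_hn : 0 < n) (hok : thr 10 * (6 * n) < Mb I 10) :
    (solveC f₀ 10 (rawOf (Jb I 10))).length = Mb I 10 ∧
      (fun p : Fin (Mb I 10) => (solveC f₀ 10 (rawOf (Jb I 10))).getD p.val false) ∉ (Jb I 10).range := by
  have hP := Jb_isPure I 10
  rw [show solveC f₀ 10 (rawOf (Jb I 10)) = sol10 (rawOf (Jb I 10)) from rfl]
  rw [show thr 10 = 2 from rfl] at hok
  refine ⟨?_, sol10_correct (Jb I 10) hP (by omega)⟩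
  rw [length_sol10]; rfl

/-- Class `11`: the dispatched solver is correct on the relaxed bucket and has the right length. -/
theorem solveC_correct_11 (_hn : 0 < n) (hok : thr 11 * (6 * n) < Mb I 11) :
    (solveC f₀ 11 (rawOf (Jb I 11))).length = Mb I 11 ∧
      (fun p : Fin (Mb I 11) => (solveC f₀ 11 (rawOf (Jb I 11))).getD p.val false) ∉ (Jb I 11).range := by
  have hP := Jb_isPure I 11
  rw [show solveC f₀ 11 (rawOf (Jb I 11)) = sol11 (rawOf (Jb I 11)) from rfl]
  rw [show thr 11 = 2 from rfl] at hok
  refine ⟨?_, sol11_correct (Jb I 11) hP (by omega)⟩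
  rw [length_sol11]; rfl

/-- Class `12`: the dispatched solver is correct on the relaxed bucket and has the right length. -/
theorem solveC_correct_12 (_hn : 0 < n) (hok : thr 12 * (6 * n) < Mb I 12) :
    (solveC f₀ 12 (rawOf (Jb I 12))).length = Mb I 12 ∧
      (fun p : Fin (Mb I 12) => (solveC f₀ 12 (rawOf (Jb I 12))).getD p.val false) ∉ (Jb I 12).range := by
  have hP := Jb_isPure I 12
  rw [show solveC f₀ 12 (rawOf (Jb I 12)) = sol12 (rawOf (Jb I 12)) from rfl]
  rw [show thr 12 = 5 from rfl] at hok
  haveI : NeZero (Mb I 12) := ⟨by omega⟩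
  exact ⟨length_sol12 (Jb I 12), sol12_correct (Jb I 12) hP (by omega)⟩

/-- The solver of a qualifying class `≤ 12` is correct on the relaxed bucket and has the right length. -/
theorem solveC_correct_lt (hn : 0 < n) {c : ℕ} (hc : c < 13) (hok : thr c * (6 * n) < Mb I c) :
    (solveC f₀ c (rawOf (Jb I c))).length = Mb I c ∧
      (fun p : Fin (Mb I c) => (solveC f₀ c (rawOf (Jb I c))).getD p.val false) ∉ (Jb I c).range := by
  have h13 : c = 0 ∨ c = 1 ∨ c = 2 ∨ c = 3 ∨ c = 4 ∨ c = 5 ∨ c = 6 ∨ c = 7 ∨ c = 8 ∨ c = 9 ∨ c = 10 ∨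
      c = 11 ∨ c = 12 := by omega
  rcases h13 with rfl | rfl | rfl | rfl | rfl | rfl | rfl | rfl | rfl | rfl | rfl | rfl | rfl
  · exact solveC_correct_0 I hn hok
  · exact solveC_correct_1 I hn hok
  · exact solveC_correct_2 I hn hok
  · exact solveC_correct_3 I hn hok
  · exact solveC_correct_4 I hn hok
  · exact solveC_correct_5 I hn hok
  · exact solveC_correct_6 I hn hok
  · exact solveC_correct_7 I hn hok
  · exact solveC_correct_8 I hn hok
  · exact solveC_correct_9 I hn hok
  · exact solveC_correct_10 I hn hok
  · exact solveC_correct_11 I hn hok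
  · exact solveC_correct_12 I hn hok

/-- If no class `≤ 12` qualifies, the `CAND` bucket is large. -/
theorem Mb13_large (hno : ∀ c < 13, classOK (toRaw ⟨n, m, I⟩) c = false) : m ≤ Mb I 13 + 150 * n := by
  have hsum := sum_Mb I
  rw [Finset.sum_range_succ] at hsum
  have hle : ∑ c ∈ Finset.range 13, Mb I c ≤ ∑ c ∈ Finset.range 13, thr c * (6 * n) := by
    apply Finset.sum_le_sum
    intro c hc
    have h := hno c (Finset.mem_range.1 hc)
    unfold classOK at h
    rw [decide_eq_false_iff_not, cntC_toRaw] at h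
    exact not_lt.1 h
  rw [← Finset.sum_mul, sum_thr] at hle
  omega

/-- The solver of the `CAND` class is correct on the relaxed bucket, given the oracle. -/
theorem solveC_correct_13
    (hf₀ : ∀ N M (J : LocalMap 3 N M), J.IsPure candPred → 0 < N → C₀ * N ≤ M → readOut M (f₀ J.encode) ∉ J.range)
    (hn : 0 < n) (hm : (6 * C₀ + 150) * n ≤ m) (hno : ∀ c < 13, classOK (toRaw ⟨n, m, I⟩) c = false) :
    (solveC f₀ 13 (rawOf (Jb I 13))).length = Mb I 13 ∧
      (fun p : Fin (Mb I 13) => (solveC f₀ 13 (rawOf (Jb I 13))).getD p.val false) ∉ (Jb I 13).range := by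
  have hP := Jb_isPure I 13
  have hlarge := Mb13_large I hno
  rw [show solveC f₀ 13 (rawOf (Jb I 13)) = sol13 f₀ (rawOf (Jb I 13)) from rfl]
  refine ⟨by rw [length_sol13]; rfl, sol13_correct hf₀ _ hP (by omega) ?_⟩
  have : (6 * C₀ + 150) * n = C₀ * (6 * n) + 150 * n := by ring
  omega

/-- **The assembled solver is correct** on every instance with `0 < n` and `(6 C₀ + 150) n ≤ m`. -/
theorem outBits_correct
    (hf₀ : ∀ N M (J : LocalMap 3 N M), J.IsPure candPred → 0 < N → C₀ * N ≤ M → readOut M (f₀ J.encode) ∉ J.range)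
    (hn : 0 < n) (hm : (6 * C₀ + 150) * n ≤ m) :
    (fun j : Fin m => (outBits f₀ (toRaw ⟨n, m, I⟩)).getD j.val false) ∉ I.range := by
  have key : ∀ c, c = chooseClass (toRaw ⟨n, m, I⟩) →
      (solveC f₀ c (rawOf (Jb I c))).length = Mb I c ∧
        (fun p : Fin (Mb I c) => (solveC f₀ c (rawOf (Jb I c))).getD p.val false) ∉ (Jb I c).range := by
    intro c hc
    rcases chooseClass_spec (toRaw ⟨n, m, I⟩) with ⟨hlt, hok⟩ | ⟨h13, hno⟩
    · rw [← hc] at hlt hok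
      unfold classOK at hok
      rw [decide_eq_true_eq, cntC_toRaw] at hok
      exact solveC_correct_lt I hn hlt hok
    · rw [← hc] at h13
      subst h13
      exact solveC_correct_13 I hf₀ hn hm hno
  obtain ⟨hlen, hJ⟩ := key _ rfl
  unfold outBits
  rw [show (toRaw ⟨n, m, I⟩ : RI).2.2 = List.ofFn (recOf I) from rfl, ← rawOf_Jb]
  exact scatter_not_mem I _ hlen hJ

end Correct

end Summit.PneNP.PneNP.Theorems.Nc03Reduction
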